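import Mathlib
import HarnessLib
import Summits.HubbardSuperconductivity.HubbardSuperconductivity.Theorems.KLProgrammeKLRegimeEnginePairLadderTowerCompose

/-!
# Route `KLProgramme` — crux K3, ENGINE child gen 5 (stmt-HubbardSuperconductivity-19918 `KLRegimeEngineV14`), stub `stub_engine_step_values`,
# conjunct (E2-v9) at `1 ≤ n`: MULTISTEP composed-map remainder propagation (the discrete weighted Duhamel formula) — `kltc_multistep_compose`

Cell gate-hubbard-kl, seat hubbard-kl-k3c1-p1 (g5), technique «composed-map remainder propagation».  `N` consecutive one-step resummations with
entrywise errors, `Γ_{i+1} ≈ F_{w_i}(Γ_i)` (`(1 + diag w_i·Γ_i)·N_i = 1`, `‖Γ_{i+1} − Γ_i·N_i‖ ≤ E_i`), under an A PRIORI entry bound `|Γ_i| ≤ m`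
at every intermediate step and a majorant profile `ρ` of every weight and every weight TAIL `Σ_{j ≥ i} w_j` with `(3/2)m·Σρ ≤ 1/3`, compose into
`Γ_N ≈ F_{Σ_i w_i}(Γ_0)` with a two-sided inverse witness and the error
`Σ_{i<N} FT_ρ(E_i)`, `FT_ρ(E)(x,y) = E(x,y) + (3/2)(3/2 m)·Σ_b E(x,b)ρ_b + (3/2)m·Σ_a ρ_a E(a,y) + (9/4)m(3/2 m)·Σ_aΣ_b ρ_a E(a,b)ρ_b`
— constants UNIFORM in `N` (no `(3/2)^N`: the telescoping `Γ_N − F_W(Γ_0) = Σ_i [F_{W_{>i}}(Γ_{i+1}) − F_{W_{>i}}(F_{w_i}(Γ_i))]`, `F_{W_{>i}}∘F_{w_i} = F_{W_{≥i}}`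
by `klli_compose`, each bracket one `klell_kernel_perturbation` between kernels bounded a priori).  This is the discrete weighted Duhamel formula
for the Bethe–Salpeter/Riccati recursion; with `N = 1` it is the one-step bridge, with sign flips it contains `kltc_tower_compose`.

Why (design note for the (E2) prover, option (C)/(A)/(B) alike): SUB-SLICING.  Cut slice `n` into `N` thin sub-slices `g_{n,i}`; every sub-step is
EXACT to second order in the Wick-ordered scheme (`klw_wickAction_succ_secondOrder`, p481972/p484175: no first-order term, second order = difference of
Wick star products whose pp bubble carries `w_i = B(D_i⊗D_i) − B(D_{i+1}⊗D_{i+1})`, `Σ_i w_i` = the full slice rung) up to the third-order remainder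
`R₃,i = O(ε_i²)` (`GrassmannEffectiveActionTruncation`), and `F_{w_i}(Γ_i) − (Γ_i − Γ_i w_i Γ_i)` is `≤ (3/2)m³σ_i²` entrywise (`σ_i = Σ|w_i|`): both sum
to `O(1/N)`.  Hence `E_i` = [ph bubbles + leg terms + higher-kernel two-vertex terms of sub-step `i`] + `O(ε_i² + σ_i²)`, `Σ_i E_i` has the (E2-v9)
SHAPE, and this theorem + `kltc_fourTerm_shaped_le` + `klam_phGain3_angular_le` close the Wick pair-ladder step (W-a)_n WITHOUT the all-orders
cumulant structure / chain extraction (E2-WICK-ROADMAP §5 (i)): only two-vertex graphs are ever read.  Exact algebra + kernel perturbations;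
nothing about the model is asserted.  0 kit.
-/

noncomputable section

namespace Summit.HubbardSuperconductivity.HubbardSuperconductivity.Theorems.KLRegimeSplit

set_option linter.dupNamespace false -- summit = problem name (single-conjunct summit), D-0017

open Finset Matrix Literature.MathematicalPhysics.QuantumLattice Literature.Probability.LatticeModels
open Summit.HubbardSuperconductivity.HubbardSuperconductivity.Theorems.KLProgrammeCooperResummation

section Multistep

variable {S : Type*} [Fintype S] [DecidableEq S] [Nonempty S]

/-- **Multistep composed-map remainder propagation (discrete weighted Duhamel).**  Arrays `Γ_0, …, Γ_N` with `|Γ_i| ≤ m` (a priori), weights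
`w_0, …, w_{N−1}` with `|w_i| ≤ ρ` and `|Σ_{i ≤ j < N} w_j| ≤ ρ` termwise, right inverses `N_i` of `1 + diag w_i·Γ_i`, entrywise errors
`‖Γ_{i+1} − Γ_i·N_i‖ ≤ E_i`, smallness `(3/2)m·Σρ ≤ 1/3`.  THEN `1 + diag(Σ_{j<N} w_j)·Γ_0` has a two-sided inverse `N_tot` and
`‖Γ_N − Γ_0·N_tot‖(x,y) ≤ Σ_{i<N} [E_i(x,y) + (3/2)(3/2 m)·Σ_b E_i(x,b)ρ_b + (3/2)m·Σ_a ρ_a E_i(a,y) + (9/4)m(3/2 m)·Σ_aΣ_b ρ_a E_i(a,b)ρ_b]`. -/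
theorem kltc_multistep_compose (N : ℕ) :
    ∀ (Γ Nw : ℕ → Matrix S S ℂ) (w : ℕ → S → ℂ) (E : ℕ → S → S → ℝ) (ρ : S → ℝ) {m : ℝ}, 0 ≤ m →
      (∀ i, i ≤ N → ∀ x y, ‖Γ i x y‖ ≤ m) → (∀ i, i < N → ∀ a, ‖w i a‖ ≤ ρ a) →
      (∀ i a, ‖∑ j ∈ Ico i N, w j a‖ ≤ ρ a) →
      (∀ i, i < N → (1 + diagonal (w i) * Γ i) * Nw i = 1) →
      (∀ i, i < N → ∀ x y, ‖Γ (i + 1) x y - (Γ i * Nw i) x y‖ ≤ E i x y) →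
      3 / 2 * m * ∑ a, ρ a ≤ 1 / 3 →
      ∃ Nt : Matrix S S ℂ, (1 + diagonal (fun a => ∑ j ∈ range N, w j a) * Γ 0) * Nt = 1 ∧
        Nt * (1 + diagonal (fun a => ∑ j ∈ range N, w j a) * Γ 0) = 1 ∧
        ∀ x y, ‖Γ N x y - (Γ 0 * Nt) x y‖ ≤ ∑ i ∈ range N, (E i x y + 3 / 2 * (3 / 2 * m) * ∑ b, E i x b * ρ b +
          3 / 2 * m * ∑ a, ρ a * E i a y + 9 / 4 * m * (3 / 2 * m) * ∑ a, ∑ b, ρ a * E i a b * ρ b) := by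
  induction N with
  | zero =>
    intro Γ Nw w E ρ m hm hΓ hw hW hN hE hsm
    have h0 : (fun a => ∑ j ∈ range 0, w j a) = fun _ => (0 : ℂ) := by funext a; simp
    refine ⟨1, ?_, ?_, fun x y => ?_⟩
    · rw [h0, diagonal_zero, zero_mul, add_zero, mul_one]
    · rw [h0, diagonal_zero, zero_mul, add_zero, mul_one]
    · rw [Matrix.mul_one, sub_self, norm_zero, sum_range_zero]
  | succ N ih =>
    intro Γ Nw w E ρ m hm hΓ hw hW hN hE hsm
    -- nonnegativity / masses
    have hρ0 : ∀ a, 0 ≤ ρ a := fun a => (norm_nonneg _).trans (hw 0 (Nat.succ_pos N) a)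
    have hZ0 : 0 ≤ ∑ a, ρ a := sum_nonneg fun a _ => hρ0 a
    have hm₀ : 0 ≤ 3 / 2 * m := by positivity
    have hsmC : m * ∑ a, ρ a ≤ 1 / 3 := (mul_le_mul_of_nonneg_right (by linarith : m ≤ 3 / 2 * m) hZ0).trans hsm
    -- the shifted data
    obtain ⟨Nt', hNt'1, -, hbd'⟩ := ih (fun i => Γ (i + 1)) (fun i => Nw (i + 1)) (fun i => w (i + 1)) (fun i => E (i + 1)) ρ hm
      (fun i hi x y => hΓ (i + 1) (by omega) x y) (fun i hi a => hw (i + 1) (by omega) a)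
      (fun i a => by
        have h := hW (i + 1) a
        rwa [← sum_Ico_add'] at h)
      (fun i hi => hN (i + 1) (by omega)) (fun i hi x y => hE (i + 1) (by omega) x y) hsm
    -- the tail weights `z = W_{≥1}`
    set z : S → ℂ := fun a => ∑ j ∈ range N, w (j + 1) a with hz_def
    have hzρ : ∀ a, ‖z a‖ ≤ ρ a := by
      intro a
      have h := hW (0 + 1) a
      rw [← sum_Ico_add', Nat.Ico_zero_eq_range] at h
      exact h
    have hZz : ∑ a, ‖z a‖ ≤ ∑ a, ρ a := sum_le_sum fun a _ => hzρ a
    have hZzK : m * ∑ a, ‖z a‖ ≤ 1 / 3 := (mul_le_mul_of_nonneg_left hZz hm).trans hsmC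
    have hZzC : 3 / 2 * m * ∑ a, ‖z a‖ ≤ 1 / 3 := (mul_le_mul_of_nonneg_left hZz hm₀).trans hsm
    -- step 0: `C := Γ_0 N_0 = F_{w_0}(Γ_0)`, entry bound `(3/2)m`
    have hw0 : m * ∑ a, ‖w 0 a‖ ≤ 1 / 3 :=
      (mul_le_mul_of_nonneg_left (sum_le_sum fun a _ => hw 0 (Nat.succ_pos N) a) hm).trans hsmC
    obtain ⟨N₀, _, hN₀1, hN₀2, -, -, -, -, -, hC₀N₀, -, -⟩ := klcrs_single_slice (w 0) hm (Γ 0) (hΓ 0 (Nat.zero_le _)) hw0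
    have hNN : Nw 0 = N₀ := by
      calc Nw 0 = N₀ * (1 + diagonal (w 0) * Γ 0) * Nw 0 := by rw [hN₀2, one_mul]
        _ = N₀ := by rw [mul_assoc, hN 0 (Nat.succ_pos N), mul_one]
    set C : Matrix S S ℂ := Γ 0 * Nw 0 with hC_def
    have hCb : ∀ x y, ‖C x y‖ ≤ 3 / 2 * m := by intro x y; rw [hC_def, hNN]; exact hC₀N₀ x y
    -- resum `C` at `z` and compare with `Γ_1` resummed at `z`
    obtain ⟨M', _, hM'1, -, -, -, -, -, -, -, -, -⟩ := klcrs_single_slice z hm₀ C hCb hZzC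
    have hNt'1 : (1 + diagonal z * Γ 1) * Nt' = 1 := hNt'1
    have hbd' : ∀ x y, ‖Γ (N + 1) x y - (Γ 1 * Nt') x y‖ ≤ ∑ i ∈ range N, (E (i + 1) x y +
        3 / 2 * (3 / 2 * m) * ∑ b, E (i + 1) x b * ρ b + 3 / 2 * m * ∑ a, ρ a * E (i + 1) a y +
          9 / 4 * m * (3 / 2 * m) * ∑ a, ∑ b, ρ a * E (i + 1) a b * ρ b) := hbd'
    have hTK := (klcrs_single_slice_ladder_hasSum z hm (Γ 1) (hΓ 1 (by omega)) hZzK Nt' hNt'1).2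
    have hTC := (klcrs_single_slice_ladder_hasSum z hm₀ C hCb hZzC M' hM'1).2
    have hE0 : ∀ x y, 0 ≤ E 0 x y := fun x y => (norm_nonneg _).trans (hE 0 (Nat.succ_pos N) x y)
    have hstep : ∀ x y, ‖(Γ 1 * Nt') x y - (C * M') x y‖ ≤ E 0 x y + 3 / 2 * (3 / 2 * m) * ∑ b, E 0 x b * ρ b +
        3 / 2 * m * ∑ a, ρ a * E 0 a y + 9 / 4 * m * (3 / 2 * m) * ∑ a, ∑ b, ρ a * E 0 a b * ρ b := by
      intro x y
      have h := klell_kernel_perturbation (Γ 1) C z hm₀ hm hCb (hΓ 1 (by omega)) hZzC hZzK (Γ 1 * Nt') (C * M') hTK hTC x y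
      have hEnt : ∀ a b, ‖(Γ 1 - C) a b‖ ≤ E 0 a b := fun a b => by rw [Matrix.sub_apply]; exact hE 0 (Nat.succ_pos N) a b
      have h2 : ∑ b, ‖(Γ 1 - C) x b‖ * ‖z b‖ ≤ ∑ b, E 0 x b * ρ b :=
        sum_le_sum fun b _ => mul_le_mul (hEnt x b) (hzρ b) (norm_nonneg _) (hE0 x b)
      have h3 : ∑ a, ‖z a‖ * ‖(Γ 1 - C) a y‖ ≤ ∑ a, ρ a * E 0 a y :=
        sum_le_sum fun a _ => mul_le_mul (hzρ a) (hEnt a y) (norm_nonneg _) (hρ0 a)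
      have h4 : ∑ a, ∑ b, ‖z a‖ * ‖(Γ 1 - C) a b‖ * ‖z b‖ ≤ ∑ a, ∑ b, ρ a * E 0 a b * ρ b :=
        sum_le_sum fun a _ => sum_le_sum fun b _ =>
          mul_le_mul (mul_le_mul (hzρ a) (hEnt a b) (norm_nonneg _) (hρ0 a)) (hzρ b) (norm_nonneg _) (mul_nonneg (hρ0 a) (hE0 a b))
      have e2 : 3 / 2 * (3 / 2 * m) * ∑ b, ‖(Γ 1 - C) x b‖ * ‖z b‖ ≤ 3 / 2 * (3 / 2 * m) * ∑ b, E 0 x b * ρ b :=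
        mul_le_mul_of_nonneg_left h2 (by positivity)
      have e3 : 3 / 2 * m * ∑ a, ‖z a‖ * ‖(Γ 1 - C) a y‖ ≤ 3 / 2 * m * ∑ a, ρ a * E 0 a y := mul_le_mul_of_nonneg_left h3 (by positivity)
      have e4 : 9 / 4 * m * (3 / 2 * m) * ∑ a, ∑ b, ‖z a‖ * ‖(Γ 1 - C) a b‖ * ‖z b‖ ≤
          9 / 4 * m * (3 / 2 * m) * ∑ a, ∑ b, ρ a * E 0 a b * ρ b := mul_le_mul_of_nonneg_left h4 (by positivity)
      linarith [hEnt x y]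
    -- compose `F_z ∘ F_{w_0} = F_{w_0 + z}`
    have hcomp : (1 + (diagonal (w 0) + diagonal z) * Γ 0) * (Nw 0 * M') = 1 := klli_compose (Γ 0) (diagonal (w 0)) (diagonal z) (Nw 0) M' (hN 0 (Nat.succ_pos N)) hM'1
    have hdiag : diagonal (w 0) + diagonal z = diagonal (fun a => ∑ j ∈ range (N + 1), w j a) := by
      rw [diagonal_add]
      exact congrArg diagonal (funext fun a => by rw [hz_def, sum_range_succ' (fun j => w j a)]; ring)
    rw [hdiag] at hcomp
    refine ⟨Nw 0 * M', hcomp, mul_eq_one_comm.mp hcomp, fun x y => ?_⟩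
    have hsplit : Γ (N + 1) x y - (Γ 0 * (Nw 0 * M')) x y =
        (Γ (N + 1) x y - (Γ 1 * Nt') x y) + ((Γ 1 * Nt') x y - (C * M') x y) := by
      rw [hC_def, Matrix.mul_assoc, sub_add_sub_cancel]
    rw [hsplit, sum_range_succ' (fun i => E i x y + 3 / 2 * (3 / 2 * m) * ∑ b, E i x b * ρ b + 3 / 2 * m * ∑ a, ρ a * E i a y +
      9 / 4 * m * (3 / 2 * m) * ∑ a, ∑ b, ρ a * E i a b * ρ b)]
    exact (norm_add_le _ _).trans (add_le_add (hbd' x y) (hstep x y))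

end Multistep

end Summit.HubbardSuperconductivity.HubbardSuperconductivity.Theorems.KLRegimeSplit

end
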